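import Summits.HodgeConjecture.HodgeConjecture.Theorems.NikulinTwinTransportRealMultiplicationOfTwoSelfSimilar
import Summits.HodgeConjecture.HodgeConjecture.Theorems.NikulinTwinTransportRealMultiplicationTwoSelfSimilarOfInvariants
import Literature.AlgebraicGeometry.Surfaces.K3LatticeInvariants

/-!
# Route NikulinTwinTransport · `RealMultiplicationSqrtTwoAlgebraic` (stmt-HodgeConjecture-13679) —
# the item from X and the three NUMERICAL invariants of a K3 surface (`b₂ = 22`, even, `τ = −16`)

Helper file (supports stmt-HodgeConjecture-13679). State of the item before this file: the route
decl `RealMultiplicationSqrtTwoAlgebraic` (real multiplication by `√2` on the transcendental part of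
`H²` of a projective K3 surface is algebraic — standalone an open sub-case of the Hodge conjecture,
van Geemen–Schütt 2023 Rem. 4.9) is derived in the tree from

* X = `TwinSimilitudeAlgebraic` (stmt-HodgeConjecture-13674, used at the pairs `(S, S)` only) and
* EITHER the named fact `Huybrechts_K3_marking_exists`
  (`realMultiplicationSqrtTwoAlgebraic_of_twinSimilitude_of_marking`) OR the route-vocabulary
  hypothesis `K3TwoSelfSimilar` — a rational `2`-self-similitude `Ξ` of `(H²(S(ℂ); ℂ), ∪)` on every
  projective K3 surface (`realMultiplicationSqrtTwoAlgebraic_of_twinSimilitude_of_twoSelfSimilar`).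

Since then the librarians DECOMPOSED the marking fact (`K3LatticeInvariants.lean`) into the three
numerical inputs of Huybrechts' printed proof of Ch. 1 Prop. 3.5 — `K3_finrank_complexBetti_two`
(`b₂ = 22`: Noether's formula and `e = c₂ = 24`), `K3_even_intersectionForm` (Wu's formula) and the
complex-orientation package `K3_exists_orientation_signature_hodgeRiemann_ample` (index `−16` by
Thom–Hirzebruch; Hodge–Riemann positivity on `H^{2,0}`; an ample class) — over four analytic named
facts which are by now all THEOREMS of the tree (`Voisin2002_closedForm_top_zero_not_exact_holds`,
`Huybrechts_K3_hodgeTypes_H2_holds`, `hodgePQ_independent_of_hodgeModel_holds`,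
`exists_deRhamIsoFamily_holds`), and seat 13681-2 proved `twoSelfSimilar_of_invariants`: the
`2`-self-similitude `Ξ` exists from `b₂ = 22`, evenness and index `−16` ALONE (Milnor's theorem for
even indefinite unimodular lattices, proved in `K3MarkingProofs`, and the lattice `2`-similitude
`U(2) ↪ U`, `E₈(2) ↪ E₈`).

This file records the consequence for the item:

* `realMultiplicationSqrtTwoAlgebraic_of_twinSimilitude_of_topologicalInvariants` — the route decl
  BY NAME from X and ONE inline, purely topological hypothesis: every projective K3 surface `S` has
  a `ℤ`-orientation of `S(ℂ)` with `dim_ℂ H²(S(ℂ); ℂ) = 22`, `⟨a ∪ a, [S(ℂ)]⟩` even and intersection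
  form of index `−16`. No period point, no Hodge–Riemann positivity, no ample class, no marking.
* `realMultiplicationSqrtTwoAlgebraic_of_twinSimilitude_of_k3Invariants` — the route decl from X
  and the three named numerical facts of `K3LatticeInvariants.lean` (clauses (ii), (iii) of the
  orientation package are discarded; only its index clause (i) is used).
* `realMultiplicationSqrtTwoAlgebraic_of_twinSimilitude_of_k3Invariants'` — the same through the
  marking fact's own assembly `Huybrechts_K3_marking_exists_holds_of`, with its four analytic
  inputs discharged by their `_holds` theorems (a cross-check that the two reductions agree on the
  named-fact census: X + the three numerical facts, nothing else).

So, as of this file, item stmt-HodgeConjecture-13679 = X (open problem) + {`b₂ = 22`, even,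
`τ = −16`} (three capped, printed, purely topological facts about K3 surfaces). Everything here is
proved; no named fact is introduced. Prover seat prover-pitem-stmt-HodgeConjecture-13679-c1-0.

## References

* [Varesco2023] M. Varesco, Math. Z. 305 (2023), Thm. 2.1, Rem. 2.2.
* [Huybrechts2016K3] D. Huybrechts, Lectures on K3 Surfaces, CUP 2016, Ch. 1 Prop. 3.5 and its
  proof (p. 24), §2.4 (2.6), §3.3; Ch. 14 Cor. 1.3 (i).
* [MilnorStasheff1974] J. Milnor, J. Stasheff, Characteristic Classes, Thm. 11.14, Thm. 19.4.
* [VanGeemenSchuett2023] B. van Geemen, M. Schütt, arXiv:2310.05196, Rem. 4.9.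
-/

noncomputable section

-- `Summit.HodgeConjecture.HodgeConjecture.Theorems` is the mandated namespace (single-problem summit:
-- Problem = Summit), which `linter.dupNamespace` flags; the lakefile turns the linter off tree-wide
-- (weak option), restated here so stand-alone elaboration is warning-free too.
set_option linter.dupNamespace false

namespace Summit.HodgeConjecture.HodgeConjecture.Theorems.NikulinTwinTransport

open scoped Manifold
open CategoryTheory Module
open Literature.AlgebraicGeometry Literature.AlgebraicGeometry.Motives
open Literature.AlgebraicGeometry.HodgeTheory Literature.AlgebraicGeometry.Surfaces
open Literature.AlgebraicTopology.SingularHomology Literature.Topology.FourManifolds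

/-- **`RealMultiplicationSqrtTwoAlgebraic` (item stmt-HodgeConjecture-13679, the route decl by name)
from X = Sim₂(K3) and the purely topological invariants of a K3 surface.** Hypotheses: X
(`TwinSimilitudeAlgebraic`, used at the pairs `(S, S)` only) and, for every projective K3 surface
`S` (`IsK3Surface` unfolded as in the route), a `ℤ`-orientation `μ` of `S(ℂ)` with
`dim_ℂ H²(S(ℂ); ℂ) = 22`, `⟨a ∪ a, [S(ℂ)]_μ⟩` even for all integral `a`, and intersection form of
index `−16`. Proof: `twoSelfSimilar_of_invariants` (Milnor's theorem + the lattice `2`-similitude of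
`Λ_{K3}`) supplies the rational `2`-self-similitude `Ξ` of `H²(S)`, and
`realMultiplicationSqrtTwoAlgebraic_of_twinSimilitude_of_twoSelfSimilar` (Varesco's factorisation
with the Witt correction, X at `(S, S)` for `±e + ν̃`) concludes.
[cite: Varesco2023, Thm. 2.1 and Rem. 2.2] [cite: Huybrechts2016K3, Ch. 1 Prop. 3.5 and its proof (p. 24); Ch. 14 Cor. 1.3 (i)] -/
theorem realMultiplicationSqrtTwoAlgebraic_of_twinSimilitude_of_topologicalInvariants
    (hX : Theses.NikulinTwinTransport.TwinSimilitudeAlgebraic)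
    (hinv : ∀ (S : SchemeOver ℂ),
      (IsSmoothProjective 2 S ∧ Subsingleton (structureSheafCohomology S.left 1) ∧
        ∃ (A : HodgeModel 2 S) (η : Literature.Geometry.Kaehler.MForm 𝓘(ℝ, A.model) A.carrier ℂ 2),
          Literature.Geometry.Kaehler.IsHolomorphicInCharts η ∧ ∀ x, η x ≠ 0) →
      ∃ μ : HomologicalOrientation ℤ (ComplexPoints S) (2 * 2),
        Module.finrank ℂ (complexBetti S (2 * 1)) = 22 ∧
        (∀ a : singularCohomology ℤ ℤ (ComplexPoints S) (2 * 1),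
          Even (kroneckerPairing ℤ ℤ (ComplexPoints S) (2 * 2)
            (cupProduct (rfl : 2 * 1 + 2 * 1 = 2 * 2) a a) μ.fundamentalClass)) ∧
        (intersectionForm (rfl : 2 * 1 + 2 * 1 = 2 * 2) μ).signature = -16) :
    Theses.NikulinTwinTransport.RealMultiplicationSqrtTwoAlgebraic :=
  realMultiplicationSqrtTwoAlgebraic_of_twinSimilitude_of_twoSelfSimilar hX fun S hS => by
    obtain ⟨μ, hb2, heven, hsig⟩ := hinv S hS
    exact twoSelfSimilar_of_invariants hS.1 μ hb2 heven hsig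

/-- **`RealMultiplicationSqrtTwoAlgebraic` (item stmt-HodgeConjecture-13679) from X = Sim₂(K3) and the
three named NUMERICAL facts about K3 surfaces** — `K3_finrank_complexBetti_two` (`b₂ = 22`),
`K3_even_intersectionForm` (the intersection form is even) and
`K3_exists_orientation_signature_hodgeRiemann_ample` (of which only the index clause `τ = −16` is
used). Supersedes `realMultiplicationSqrtTwoAlgebraic_of_twinSimilitude_of_marking` on the named-fact
census: the marking fact `Huybrechts_K3_marking_exists` is replaced by the three printed inputs of
its proof, and no analytic fact remains. [cite: Varesco2023, Thm. 2.1 and Rem. 2.2]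
[cite: Huybrechts2016K3, Ch. 1 Prop. 3.5, its proof (p. 24), §2.4 (2.6) and §3.3]
[cite: MilnorStasheff1974, §11 Thm. 11.14 and §19 Thm. 19.4] -/
theorem realMultiplicationSqrtTwoAlgebraic_of_twinSimilitude_of_k3Invariants
    (hX : Theses.NikulinTwinTransport.TwinSimilitudeAlgebraic)
    (h22 : K3_finrank_complexBetti_two) (heven : K3_even_intersectionForm)
    (hpos : K3_exists_orientation_signature_hodgeRiemann_ample) :
    Theses.NikulinTwinTransport.RealMultiplicationSqrtTwoAlgebraic :=
  realMultiplicationSqrtTwoAlgebraic_of_twinSimilitude_of_topologicalInvariants hX fun S hS => by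
    obtain ⟨μ, hsig, -, -⟩ := hpos S hS
    exact ⟨μ, h22 S hS, heven S hS μ, hsig⟩

/-- **Cross-check through the marking fact's own assembly.** The same conclusion from X and the three
numerical facts, routed through `Huybrechts_K3_marking_exists_holds_of` (the librarians'
decomposition of `Huybrechts_K3_marking_exists`) with its four analytic inputs discharged by the
tree's theorems `Voisin2002_closedForm_top_zero_not_exact_holds`, `Huybrechts_K3_hodgeTypes_H2_holds`,
`hodgePQ_independent_of_hodgeModel_holds` and `exists_deRhamIsoFamily_holds`, then
`realMultiplicationSqrtTwoAlgebraic_of_twinSimilitude_of_marking`. Both reductions therefore leave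
the item resting on exactly X + {`b₂ = 22`, even, `τ = −16` package}.
[cite: Huybrechts2016K3, Ch. 1 Prop. 3.5 and its proof (p. 24)] [cite: Varesco2023, Thm. 2.1 and Rem. 2.2] -/
theorem realMultiplicationSqrtTwoAlgebraic_of_twinSimilitude_of_k3Invariants'
    (hX : Theses.NikulinTwinTransport.TwinSimilitudeAlgebraic)
    (h22 : K3_finrank_complexBetti_two) (heven : K3_even_intersectionForm)
    (hpos : K3_exists_orientation_signature_hodgeRiemann_ample) :
    Theses.NikulinTwinTransport.RealMultiplicationSqrtTwoAlgebraic :=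
  realMultiplicationSqrtTwoAlgebraic_of_twinSimilitude_of_marking hX
    (Huybrechts_K3_marking_exists_holds_of h22 heven hpos
      (fun E _ _ _ M _ _ => Voisin2002_closedForm_top_zero_not_exact_holds (E := E) (M := M))
      Huybrechts_K3_hodgeTypes_H2_holds hodgePQ_independent_of_hodgeModel_holds
      fun E _ _ _ => Literature.NumberTheory.Transcendental.exists_deRhamIsoFamily_holds E)

end Summit.HodgeConjecture.HodgeConjecture.Theorems.NikulinTwinTransport

end
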